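import Summits.CriticalPhenomena.PercolationContinuityZ3.Theorems.SahiMasterFamilyOrShapeMerged

/-!
# The OR-shape at every order, III: domination by the `0`-section family — class (B) at EVERY order

Unit `prim-master-conj` (crux anchor stmt-CriticalPhenomena-4575, helper work), gen 17; memo
`run/shared/lean/prim/prim-l12/prim-master-conj/POINTWISE.md` §18.  Concludes `…OrShapeGF` (Part I) and `…OrShapeMerged` (Part II).

THE IDENTITY (`sahiE_orShape_eq_merged_add`).  With `r_ω := (σ − X_ω)(1 − X_ω)⁻¹` (nonnegative coefficients: the variables of the `B_j`
MISSED by `ω`, times `(1 − X_ω)⁻¹`), `E_K := ∏_ω (1 − r_ω)^{−s·μ⁰(ω)}` (nonnegative coefficients, [Sahi2008, proof of Lemma 16]) and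
`Δ_ω := 1 − s·r_ω − (1 − r_ω)^s = Σ_{k≥2} (−1)^{k−1} C(s,k) r_ω^k` (nonnegative coefficients):

  `E_{n+2}(μ_p; 1_A, (1_{B_j∪S_e})_j) = M + t·(μ(A¹) − μ(A⁰))·[x^{univ}]E_K + [x^{univ}] E_K · Σ_ω μ⁰(ω)1_{A⁰}(ω)·Δ_ω`,

`M` = the merged expansion of Part II.  Mechanism: `1 − σ = (1 − X_ω)(1 − r_ω)` for every `ω`, so `Ĝ·(1−σ)^{−s} = E_K` and the two
coefficient forms of Parts I–II differ by `E_K·E_{μ⁰}[1_{A⁰}(t + s(1−r) − (1−r)^s)]`.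
CONSEQUENCES (`sahiE_orShape_ge_merged`, `sahiE_orShape_dominates`): for `A` increasing every correction is `≥ 0`, so
`E(U) ≥ M`; and if every MERGED family `(A⁰, (⋂_{j∈C} B_j)_{C∈π})` (π a set partition of the tail slots, realised as a block family of all
slots containing the block `{0}`) has Sahi functional `≥ 0`, then **`E_{n+2}(μ_p; 1_U) ≥ (1−p_e)^{n+1}·E_{n+2}(μ_p; 1_{A⁰}, 1_B) ≥ 0`** —
"OR the coordinate event into all members but one" preserves Sahi positivity at every order given the merged lower data (class (B)_k;
k = 3: gen 15, k = 4: gen 16 `Pinning.sahiE_four_orThree_nonneg` with an LP certificate, here certificate-free at every order).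
HONEST FRAMING: a closure/domination statement; `C_k` / `MasterFamilyEqIff k` remain open in general.  Axioms standard. [this work]
-/

set_option autoImplicit false

open Finset

open private SqFree.ext coeff_add coeff_sub coeff_one coeff_mul coeff_sum coeff_single coeff_C_mul coeff_C coeff_neg
  isNil_single isNil_lin IsNil.add IsNil.sub IsNil.mul_left IsNil.neg IsNil.sum
  binomB_zero_right C_mul_single single_mul_single_self rch_one
  from Literature.Combinatorics.Sahi2008.CumulationCone

noncomputable section

open scoped Classical

namespace Summit.CriticalPhenomena.PercolationContinuityZ3.Theorems

namespace OrShape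

open Function
open Literature.Combinatorics.Sahi2008
open Literature.Combinatorics.Sahi2008.SqFree
open Literature.Probability.Percolation.DecisionTree (ind ind_of_mem ind_of_not_mem ind_nonneg)

section Algebra

variable {ι : Type} [Fintype ι] (p : ι → unitInterval) (e : ι) {n : ℕ} (B : Fin (n + 1) → Set (Set ι))

omit [Fintype ι] in
/-- **`1 − σ = (1 − X_ω)(1 − r_ω)`**, i.e. `σ = X_ω + r_ω − X_ω r_ω` with `r_ω = (σ − X_ω)(1 − X_ω)⁻¹`. [this work] -/
theorem sigma_eq_base (ω : Set ι) :
    (∑ j : Fin (n + 1), single ({j} : Finset (Fin (n + 1))) (1 : ℝ)) =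
      lin (fun j => ind (B j)) ω +
        ((∑ j : Fin (n + 1), single ({j} : Finset (Fin (n + 1))) (1 : ℝ)) - lin (fun j => ind (B j)) ω) * inv1 (lin (fun j => ind (B j)) ω) -
        lin (fun j => ind (B j)) ω *
          (((∑ j : Fin (n + 1), single ({j} : Finset (Fin (n + 1))) (1 : ℝ)) - lin (fun j => ind (B j)) ω) * inv1 (lin (fun j => ind (B j)) ω)) := by
  have h := one_sub_mul_inv1' (isNil_lin (fun j => ind (B j)) ω)
  linear_combination (-((∑ j : Fin (n + 1), single ({j} : Finset (Fin (n + 1))) (1 : ℝ)) - lin (fun j => ind (B j)) ω)) * h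

omit [Fintype ι] in
/-- `r_ω` is nil. [this work] -/
theorem isNil_r (ω : Set ι) :
    (((∑ j : Fin (n + 1), single ({j} : Finset (Fin (n + 1))) (1 : ℝ)) - lin (fun j => ind (B j)) ω) *
      inv1 (lin (fun j => ind (B j)) ω)).IsNil :=
  isNil_mul_left (IsNil.sub isNil_sigma (isNil_lin _ ω)) _

omit [Fintype ι] in
/-- `r_ω` has nonnegative coefficients (`σ − X_ω = Σ_{j : ω ∉ B_j} x_j`). [this work] -/
theorem nonneg_r (ω : Set ι) :
    (((∑ j : Fin (n + 1), single ({j} : Finset (Fin (n + 1))) (1 : ℝ)) - lin (fun j => ind (B j)) ω) *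
      inv1 (lin (fun j => ind (B j)) ω)).Nonneg := by
  have hdiff : (∑ j : Fin (n + 1), single ({j} : Finset (Fin (n + 1))) (1 : ℝ)) - lin (fun j => ind (B j)) ω =
      ∑ j : Fin (n + 1), single ({j} : Finset (Fin (n + 1))) (1 - ind (B j) ω) := by
    unfold SqFree.lin
    rw [← Finset.sum_sub_distrib]
    exact Finset.sum_congr rfl fun j _ => by rw [single_sub']
  rw [hdiff]
  refine nonneg_mul (nonneg_sum fun j _ => nonneg_single _ (sub_nonneg.mpr ?_)) (nonneg_inv1 ?_)
  · unfold ind; split_ifs <;> norm_num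
  · unfold SqFree.lin
    exact nonneg_sum fun j _ => nonneg_single _ (ind_nonneg _ _)

omit [Fintype ι] in
/-- `(1−σ)^c = (1−X_ω)^c (1−r_ω)^c`. [this work] -/
theorem binomB_sigma_eq (c : ℝ) (ω : Set ι) :
    binomB c (∑ j : Fin (n + 1), single ({j} : Finset (Fin (n + 1))) (1 : ℝ)) =
      binomB c (lin (fun j => ind (B j)) ω) *
        binomB c (((∑ j : Fin (n + 1), single ({j} : Finset (Fin (n + 1))) (1 : ℝ)) - lin (fun j => ind (B j)) ω) *
          inv1 (lin (fun j => ind (B j)) ω)) := by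
  rw [binomB_mul_base (isNil_lin _ ω) (isNil_r B ω), ← sigma_eq_base B ω]

/-- **`Ĝ·(1−σ)^{−s} = E_K`**: `∏_ω (1−X_ω)^{s μ⁰(ω)} · (1−σ)^{−s} = ∏_ω (1−r_ω)^{−s μ⁰(ω)}`. [this work] -/
theorem ghat_mul_binomB_neg (s : ℝ) :
    (∏ ω, binomB (s * bernoulliWeight (update p e 0) ω) (lin (fun j => ind (B j)) ω)) *
        binomB (-s) (∑ j : Fin (n + 1), single ({j} : Finset (Fin (n + 1))) (1 : ℝ)) =
      ∏ ω, binomB (-(s * bernoulliWeight (update p e 0) ω))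
        (((∑ j : Fin (n + 1), single ({j} : Finset (Fin (n + 1))) (1 : ℝ)) - lin (fun j => ind (B j)) ω) *
          inv1 (lin (fun j => ind (B j)) ω)) := by
  have hs : (-s) = ∑ ω, (-(s * bernoulliWeight (update p e 0) ω)) := by
    rw [Finset.sum_neg_distrib, ← Finset.mul_sum, sum_bernoulliWeight, mul_one]
  rw [hs, ← prod_binomB_same _ _ (isNil_sigma (n := n)), ← Finset.prod_mul_distrib]
  refine Finset.prod_congr rfl fun ω _ => ?_
  rw [binomB_sigma_eq B _ ω, ← mul_assoc, binomB_mul_same (isNil_lin _ ω), add_neg_cancel, binomB_zero_left', one_mul]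

/-- `Ĝ = E_K·(1−σ)^{s}`. [this work] -/
theorem ghat_eq (s : ℝ) :
    (∏ ω, binomB (s * bernoulliWeight (update p e 0) ω) (lin (fun j => ind (B j)) ω)) =
      (∏ ω, binomB (-(s * bernoulliWeight (update p e 0) ω))
        (((∑ j : Fin (n + 1), single ({j} : Finset (Fin (n + 1))) (1 : ℝ)) - lin (fun j => ind (B j)) ω) *
          inv1 (lin (fun j => ind (B j)) ω))) *
        binomB s (∑ j : Fin (n + 1), single ({j} : Finset (Fin (n + 1))) (1 : ℝ)) := by
  rw [← ghat_mul_binomB_neg p e B s, mul_assoc, binomB_mul_same (isNil_sigma (n := n)), neg_add_cancel, binomB_zero_left', mul_one]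

omit [Fintype ι] in
/-- `(1−σ)(1−X_ω)⁻¹ = 1 − r_ω`. [this work] -/
theorem one_sub_sigma_mul_inv1 (ω : Set ι) :
    (1 - ∑ j : Fin (n + 1), single ({j} : Finset (Fin (n + 1))) (1 : ℝ)) * inv1 (lin (fun j => ind (B j)) ω) =
      1 - ((∑ j : Fin (n + 1), single ({j} : Finset (Fin (n + 1))) (1 : ℝ)) - lin (fun j => ind (B j)) ω) *
        inv1 (lin (fun j => ind (B j)) ω) := by
  have h := one_sub_mul_inv1' (isNil_lin (fun j => ind (B j)) ω)
  linear_combination h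

/-- `E_K` has nonnegative coefficients. [cite: Sahi2008, proof of Lemma 16 (p. 224)] -/
theorem nonneg_EK {s : ℝ} (hs : 0 ≤ s) :
    (∏ ω, binomB (-(s * bernoulliWeight (update p e 0) ω))
      (((∑ j : Fin (n + 1), single ({j} : Finset (Fin (n + 1))) (1 : ℝ)) - lin (fun j => ind (B j)) ω) *
        inv1 (lin (fun j => ind (B j)) ω))).Nonneg :=
  nonneg_prod fun ω _ => Nonneg.binomB_of_nonpos
    (neg_nonpos.mpr (mul_nonneg hs (Literature.Probability.Percolation.BHK2006.weight_nonneg (fun i => (update p e 0 i).2.1)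
      (fun i => (update p e 0 i).2.2) ω))) (nonneg_r B ω)

end Algebra

/-! ### The merged events are `e`-free; transfer `μ_{p[e↦0]} → μ_p` -/

section Free

variable {ι : Type} [Fintype ι] (p : ι → unitInterval) (e : ι) {n : ℕ} (A : Set (Set ι)) (B : Fin (n + 1) → Set (Set ι))
  (hB : ∀ j (b : Bool), secAt e b (B j) = B j)

omit [Fintype ι] in
/-- Sections of the empty event. [folklore] -/
theorem secAt_empty (b : Bool) : secAt e b (∅ : Set (Set ι)) = ∅ := by
  ext ω; simp [mem_secAt]

omit [Fintype ι] in
/-- Iterated sections at the same coordinate. [folklore] -/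
theorem secAt_secAt_eq (b b' : Bool) (X : Set (Set ι)) : secAt e b (secAt e b' X) = secAt e b' X := by
  ext ω
  simp only [mem_secAt]
  have : forceAt e b' (forceAt e b ω) = forceAt e b' ω := by
    cases b <;> cases b' <;> simp [forceAt]
  rw [this]

omit [Fintype ι] in
include hB in
/-- Finite intersections of `e`-free events are `e`-free. [folklore] -/
theorem secAt_biInter_free (b : Bool) (ρ : Finset (Fin (n + 1))) : secAt e b (⋂ j ∈ ρ, B j) = ⋂ j ∈ ρ, B j := by
  induction ρ using Finset.induction_on with
  | empty =>
    ext ω; simp [mem_secAt]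
  | insert j ρ hj ih =>
    have hsplit : (⋂ j' ∈ insert j ρ, B j') = B j ∩ ⋂ j' ∈ ρ, B j' := by
      ext ω; simp
    rw [hsplit, secAt_inter, hB j b, ih]

omit [Fintype ι] in
include hB in
/-- The merged events are `e`-free. [this work] -/
theorem secAt_merged_free (σ' : NEFinset (Fin (n + 2))) :
    secAt e false (if σ'.1 = {0} then secAt e false A else if (0 : Fin (n + 2)) ∈ σ'.1 then (∅ : Set (Set ι))
        else ⋂ j ∈ SqFree.pre σ'.1, B j) =
      (if σ'.1 = {0} then secAt e false A else if (0 : Fin (n + 2)) ∈ σ'.1 then (∅ : Set (Set ι)) else ⋂ j ∈ SqFree.pre σ'.1, B j) := by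
  split_ifs
  · exact secAt_secAt_eq e false false A
  · exact secAt_empty e false
  · exact secAt_biInter_free e B hB false _

include hB in
/-- **The merged indicator functionals do not depend on `p_e`.** [this work] -/
theorem sahiEOn_merged_update_eq (s' : unitInterval) (T : Finset (NEFinset (Fin (n + 2)))) :
    sahiEOn (bernoulliWeight (update p e s')) T (fun (σ' : NEFinset (Fin (n + 2))) =>
        ind (if σ'.1 = {0} then secAt e false A else if (0 : Fin (n + 2)) ∈ σ'.1 then (∅ : Set (Set ι))
          else ⋂ j ∈ SqFree.pre σ'.1, B j)) =
      sahiEOn (bernoulliWeight p) T (fun (σ' : NEFinset (Fin (n + 2))) =>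
        ind (if σ'.1 = {0} then secAt e false A else if (0 : Fin (n + 2)) ∈ σ'.1 then (∅ : Set (Set ι))
          else ⋂ j ∈ SqFree.pre σ'.1, B j)) := by
  unfold sahiEOn
  exact sahiE_ind_update_of_free p e s' (F := fun i => if ((T.equivFin.symm i : T) : NEFinset (Fin (n + 2))).1 = {0}
      then secAt e false A else if (0 : Fin (n + 2)) ∈ ((T.equivFin.symm i : T) : NEFinset (Fin (n + 2))).1 then (∅ : Set (Set ι))
      else ⋂ j ∈ SqFree.pre ((T.equivFin.symm i : T) : NEFinset (Fin (n + 2))).1, B j) fun i => secAt_merged_free e A B hB _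

end Free

/-! ### The identity and the domination theorem -/

section Main

variable {ι : Type} [Fintype ι] (p : ι → unitInterval) (e : ι) {n : ℕ} (A : Set (Set ι)) (B : Fin (n + 1) → Set (Set ι))

/-- **THE IDENTITY** `E(U) = M + t·(μ(A¹) − μ(A⁰))·[x^univ]E_K + [x^univ] E_K·Σ_ω μ⁰(ω)1_{A⁰}(ω)Δ_ω` (module docstring), for ANY
events `A, B_j` and any `p` in the closed cube. [this work] -/
theorem sahiE_orShape_eq_merged_add :
    sahiE (bernoulliWeight p) (n + 2) (Matrix.vecCons (ind A) (fun j => ind (B j ∪ {ω' : Set ι | e ∈ ω'}))) =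
      (∑ T ∈ blockFamilies (univ : Finset (Fin (n + 2))),
        sahiEOn (bernoulliWeight (update p e 0)) T (fun (σ' : NEFinset (Fin (n + 2))) (ω : Set ι) =>
          (if σ'.1 = {0} then (1 : ℝ) else if (0 : Fin (n + 2)) ∈ σ'.1 then 0
            else (-1 : ℝ) ^ (σ'.1.card + 1) * rch σ'.1.card (1 - (p e : ℝ)) * (σ'.1.card.factorial : ℝ)) *
          ind (if σ'.1 = {0} then secAt e false A else if (0 : Fin (n + 2)) ∈ σ'.1 then (∅ : Set (Set ι))
            else ⋂ j ∈ SqFree.pre σ'.1, B j) ω)) +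
      (p e : ℝ) * (ex (bernoulliWeight p) (ind (secAt e true A)) - ex (bernoulliWeight p) (ind (secAt e false A))) *
        (∏ ω, binomB (-((1 - (p e : ℝ)) * bernoulliWeight (update p e 0) ω))
          (((∑ j : Fin (n + 1), single ({j} : Finset (Fin (n + 1))) (1 : ℝ)) - lin (fun j => ind (B j)) ω) *
            inv1 (lin (fun j => ind (B j)) ω))).coeff univ +
      ((∏ ω, binomB (-((1 - (p e : ℝ)) * bernoulliWeight (update p e 0) ω))
          (((∑ j : Fin (n + 1), single ({j} : Finset (Fin (n + 1))) (1 : ℝ)) - lin (fun j => ind (B j)) ω) *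
            inv1 (lin (fun j => ind (B j)) ω))) *
        ∑ ω, C (bernoulliWeight (update p e 0) ω * ind (secAt e false A) ω) *
          (1 - C (1 - (p e : ℝ)) * ((((∑ j : Fin (n + 1), single ({j} : Finset (Fin (n + 1))) (1 : ℝ)) - lin (fun j => ind (B j)) ω) *
            inv1 (lin (fun j => ind (B j)) ω))) -
            binomB (1 - (p e : ℝ)) ((((∑ j : Fin (n + 1), single ({j} : Finset (Fin (n + 1))) (1 : ℝ)) - lin (fun j => ind (B j)) ω) *
            inv1 (lin (fun j => ind (B j)) ω))))).coeff univ := by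
  rw [sahiE_orShape_eq_coeff p e A B, merged_eq_coeff p e A B (1 - (p e : ℝ))]
  -- abbreviations
  set s : ℝ := 1 - (p e : ℝ) with hs
  set t : ℝ := (p e : ℝ) with ht
  set μ0 : Set ι → ℝ := bernoulliWeight (update p e 0) with hμ0
  set σ : SqFree (Fin (n + 1)) ℝ := ∑ j : Fin (n + 1), single ({j} : Finset (Fin (n + 1))) (1 : ℝ) with hσ
  set a1 : ℝ := ex (bernoulliWeight p) (ind (secAt e true A)) with ha1
  set a0 : ℝ := ex (bernoulliWeight p) (ind (secAt e false A)) with ha0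
  set EK : SqFree (Fin (n + 1)) ℝ := ∏ ω, binomB (-(s * μ0 ω))
      ((σ - lin (fun j => ind (B j)) ω) * inv1 (lin (fun j => ind (B j)) ω)) with hEK
  set G : SqFree (Fin (n + 1)) ℝ := ∏ ω, binomB (s * μ0 ω) (lin (fun j => ind (B j)) ω) with hG
  -- the rewrites
  have hst : C s + C t = (1 : SqFree (Fin (n + 1)) ℝ) := by rw [← map_add, hs, ht, sub_add_cancel, map_one]
  have hGE : G = EK * binomB s σ := ghat_eq p e B s
  have h1 : binomB s σ * binomB t σ = 1 - σ := by
    rw [binomB_mul_same (isNil_sigma (n := n)), hs, ht, sub_add_cancel, binomB_one_left' (isNil_sigma (n := n))]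
  have h3 : (1 - σ) * inv1 σ = 1 := one_sub_mul_inv1' (isNil_sigma (n := n))
  have h4 : ∀ ω, binomB s σ * binomB (-s) (lin (fun j => ind (B j)) ω) =
      binomB s ((σ - lin (fun j => ind (B j)) ω) * inv1 (lin (fun j => ind (B j)) ω)) := by
    intro ω
    rw [hσ, binomB_sigma_eq B s ω, mul_right_comm, binomB_mul_same (isNil_lin _ ω), add_neg_cancel, binomB_zero_left', one_mul]
  have ha0sum : ∑ ω, C (μ0 ω * ind (secAt e false A) ω) = (C a0 : SqFree (Fin (n + 1)) ℝ) := by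
    rw [← map_sum, ha0, ← ex_ind_update_of_free p e 0 (secAt_secAt_eq e false false A), ex_def]
  -- sums as atoms
  set S0 : SqFree (Fin (n + 1)) ℝ := ∑ ω, C (μ0 ω * ind (secAt e false A) ω) with hS0
  set S1 : SqFree (Fin (n + 1)) ℝ := ∑ ω, C (μ0 ω * ind (secAt e false A) ω) *
      ((σ - lin (fun j => ind (B j)) ω) * inv1 (lin (fun j => ind (B j)) ω)) with hS1
  set S2 : SqFree (Fin (n + 1)) ℝ := ∑ ω, C (μ0 ω * ind (secAt e false A) ω) *
      binomB s ((σ - lin (fun j => ind (B j)) ω) * inv1 (lin (fun j => ind (B j)) ω)) with hS2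
  have hL : G * binomB t σ * (C s * ∑ ω, C (μ0 ω * ind (secAt e false A) ω) * inv1 (lin (fun j => ind (B j)) ω) +
      C (t * a1) * inv1 σ) = EK * (C s * (S0 - S1) + C t * C a1) := by
    have hY : (1 - σ) * ∑ ω, C (μ0 ω * ind (secAt e false A) ω) * inv1 (lin (fun j => ind (B j)) ω) = S0 - S1 := by
      rw [hS0, hS1, ← Finset.sum_sub_distrib, Finset.mul_sum]
      refine Finset.sum_congr rfl fun ω _ => ?_
      rw [mul_left_comm, hσ, one_sub_sigma_mul_inv1 B ω]
      ring
    rw [hGE, map_mul]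
    calc EK * binomB s σ * binomB t σ * (C s * ∑ ω, C (μ0 ω * ind (secAt e false A) ω) * inv1 (lin (fun j => ind (B j)) ω) +
          C t * C a1 * inv1 σ)
        = EK * (C s * ((binomB s σ * binomB t σ) * ∑ ω, C (μ0 ω * ind (secAt e false A) ω) * inv1 (lin (fun j => ind (B j)) ω)) +
            C t * C a1 * ((binomB s σ * binomB t σ) * inv1 σ)) := by ring
      _ = EK * (C s * (S0 - S1) + C t * C a1) := by rw [h1, hY, h3, mul_one]
  have hM : G * ∑ ω, C (μ0 ω * ind (secAt e false A) ω) * binomB (-s) (lin (fun j => ind (B j)) ω) = EK * S2 := by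
    rw [hGE, hS2, mul_assoc, Finset.mul_sum]
    congr 1
    refine Finset.sum_congr rfl fun ω _ => ?_
    rw [mul_left_comm, h4 ω]
  have hR : ∑ ω, C (μ0 ω * ind (secAt e false A) ω) *
      (1 - C s * ((σ - lin (fun j => ind (B j)) ω) * inv1 (lin (fun j => ind (B j)) ω)) -
        binomB s ((σ - lin (fun j => ind (B j)) ω) * inv1 (lin (fun j => ind (B j)) ω))) = S0 - C s * S1 - S2 := by
    rw [hS0, hS1, hS2, Finset.mul_sum, ← Finset.sum_sub_distrib, ← Finset.sum_sub_distrib]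
    exact Finset.sum_congr rfl fun ω _ => by ring
  have key : G * binomB t σ * (C s * ∑ ω, C (μ0 ω * ind (secAt e false A) ω) * inv1 (lin (fun j => ind (B j)) ω) +
      C (t * a1) * inv1 σ) =
      G * ∑ ω, C (μ0 ω * ind (secAt e false A) ω) * binomB (-s) (lin (fun j => ind (B j)) ω) +
        C (t * (a1 - a0)) * EK +
        EK * ∑ ω, C (μ0 ω * ind (secAt e false A) ω) *
          (1 - C s * ((σ - lin (fun j => ind (B j)) ω) * inv1 (lin (fun j => ind (B j)) ω)) -
            binomB s ((σ - lin (fun j => ind (B j)) ω) * inv1 (lin (fun j => ind (B j)) ω))) := by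
    have hC : (C (t * (a1 - a0)) : SqFree (Fin (n + 1)) ℝ) = C t * C a1 - C t * S0 := by
      rw [ha0sum, map_mul, map_sub, mul_sub]
    rw [hL, hM, hR, hC]
    linear_combination EK * S0 * hst
  have h := congrArg (fun z : SqFree (Fin (n + 1)) ℝ => z.coeff univ) key
  simp only [coeff_add, coeff_C_mul'] at h
  rw [h]

/-- **`E(U) ≥ M`** for `A` increasing (`B_j` any events): the two corrections in the identity are `≥ 0`. [this work] -/
theorem sahiE_orShape_ge_merged (hA : IsUpperSet A) :
    (∑ T ∈ blockFamilies (univ : Finset (Fin (n + 2))),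
        sahiEOn (bernoulliWeight (update p e 0)) T (fun (σ' : NEFinset (Fin (n + 2))) (ω : Set ι) =>
          (if σ'.1 = {0} then (1 : ℝ) else if (0 : Fin (n + 2)) ∈ σ'.1 then 0
            else (-1 : ℝ) ^ (σ'.1.card + 1) * rch σ'.1.card (1 - (p e : ℝ)) * (σ'.1.card.factorial : ℝ)) *
          ind (if σ'.1 = {0} then secAt e false A else if (0 : Fin (n + 2)) ∈ σ'.1 then (∅ : Set (Set ι))
            else ⋂ j ∈ SqFree.pre σ'.1, B j) ω)) ≤
      sahiE (bernoulliWeight p) (n + 2) (Matrix.vecCons (ind A) (fun j => ind (B j ∪ {ω' : Set ι | e ∈ ω'}))) := by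
  rw [sahiE_orShape_eq_merged_add p e A B]
  have hs0 : 0 ≤ 1 - (p e : ℝ) := sub_nonneg.mpr (p e).2.2
  have hs1 : 1 - (p e : ℝ) ≤ 1 := sub_le_self 1 (p e).2.1
  have hEK := nonneg_EK p e B hs0
  have hZ : 0 ≤ (∏ ω, binomB (-((1 - (p e : ℝ)) * bernoulliWeight (update p e 0) ω))
      (((∑ j : Fin (n + 1), single ({j} : Finset (Fin (n + 1))) (1 : ℝ)) - lin (fun j => ind (B j)) ω) *
        inv1 (lin (fun j => ind (B j)) ω))).coeff univ := hEK univ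
  have hν : 0 ≤ ex (bernoulliWeight p) (ind (secAt e true A)) - ex (bernoulliWeight p) (ind (secAt e false A)) :=
    Pointwise.ex_secAt_true_sub_false_nonneg p e hA
  have hR : 0 ≤ ((∏ ω, binomB (-((1 - (p e : ℝ)) * bernoulliWeight (update p e 0) ω))
          (((∑ j : Fin (n + 1), single ({j} : Finset (Fin (n + 1))) (1 : ℝ)) - lin (fun j => ind (B j)) ω) *
            inv1 (lin (fun j => ind (B j)) ω))) *
        ∑ ω, C (bernoulliWeight (update p e 0) ω * ind (secAt e false A) ω) *
          (1 - C (1 - (p e : ℝ)) * ((((∑ j : Fin (n + 1), single ({j} : Finset (Fin (n + 1))) (1 : ℝ)) - lin (fun j => ind (B j)) ω) *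
            inv1 (lin (fun j => ind (B j)) ω))) -
            binomB (1 - (p e : ℝ)) ((((∑ j : Fin (n + 1), single ({j} : Finset (Fin (n + 1))) (1 : ℝ)) - lin (fun j => ind (B j)) ω) *
            inv1 (lin (fun j => ind (B j)) ω))))).coeff univ := by
    refine (nonneg_mul hEK (nonneg_sum fun ω _ => nonneg_mul (nonneg_C (mul_nonneg ?_ (ind_nonneg _ _)))
      (nonneg_one_sub_smul_sub_binomB hs0 hs1 (isNil_r B ω) (nonneg_r B ω)))) univ
    exact Literature.Probability.Percolation.BHK2006.weight_nonneg (fun i => (update p e 0 i).2.1) (fun i => (update p e 0 i).2.2) ω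
  nlinarith [mul_nonneg (mul_nonneg (p e).2.1 hν) hZ]

/-- **CLASS (B) AT EVERY ORDER — "OR the coordinate event into all members but one".**  `A` increasing, `B_0,…,B_n` `e`-free events.
Suppose every MERGED family has nonnegative Sahi functional: for every block family `T` of all slots `{0,…,n+1}` containing the block `{0}`,
`E_{|T|}( 1_{A⁰}; (1_{⋂_{j∈σ} B_{j−1}})_{σ∈T, σ≠{0}} ) ≥ 0` (stated with the tree's `sahiEOn`; blocks through `0` other than `{0}` carry `∅` and never
occur).  Then `(1 − p_e)^{n+1} · E_{n+2}(μ_p; 1_{A⁰}, 1_{B_0}, …, 1_{B_n}) ≤ E_{n+2}(μ_p; 1_A, 1_{B_0 ∪ S_e}, …, 1_{B_n ∪ S_e})` and the latter is `≥ 0`.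
[this work] -/
theorem sahiE_orShape_dominates (hA : IsUpperSet A) (hB : ∀ j (b : Bool), secAt e b (B j) = B j)
    (H : ∀ T ∈ blockFamilies (univ : Finset (Fin (n + 2))), (⟨{0}, singleton_nonempty 0⟩ : NEFinset (Fin (n + 2))) ∈ T →
      0 ≤ sahiEOn (bernoulliWeight p) T (fun (σ' : NEFinset (Fin (n + 2))) =>
        ind (if σ'.1 = {0} then secAt e false A else if (0 : Fin (n + 2)) ∈ σ'.1 then (∅ : Set (Set ι))
          else ⋂ j ∈ SqFree.pre σ'.1, B j))) :
    (1 - (p e : ℝ)) ^ (n + 1) * sahiE (bernoulliWeight p) (n + 2) (Matrix.vecCons (ind (secAt e false A)) (fun j => ind (B j))) ≤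
        sahiE (bernoulliWeight p) (n + 2) (Matrix.vecCons (ind A) (fun j => ind (B j ∪ {ω' : Set ι | e ∈ ω'}))) ∧
      0 ≤ sahiE (bernoulliWeight p) (n + 2) (Matrix.vecCons (ind A) (fun j => ind (B j ∪ {ω' : Set ι | e ∈ ω'}))) := by
  have hs0 : 0 ≤ 1 - (p e : ℝ) := sub_nonneg.mpr (p e).2.2
  have hs1 : 1 - (p e : ℝ) ≤ 1 := sub_le_self 1 (p e).2.1
  have hge := sahiE_orShape_ge_merged p e A B hA
  set z0 : NEFinset (Fin (n + 2)) := ⟨{0}, singleton_nonempty 0⟩ with hz0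
  set T₁ : Finset (NEFinset (Fin (n + 2))) := (univ : Finset (Fin (n + 2))).map
    ⟨fun i => (⟨{i}, singleton_nonempty i⟩ : NEFinset (Fin (n + 2))), fun _ _ h => Finset.singleton_inj.mp (congrArg Subtype.val h)⟩ with hT₁
  -- every term of `M` is `≥ 0`, and the all-singletons term is `s^{n+1}·E(U⁰)`
  have hterm : ∀ T ∈ blockFamilies (univ : Finset (Fin (n + 2))),
      0 ≤ sahiEOn (bernoulliWeight (update p e 0)) T (fun (σ' : NEFinset (Fin (n + 2))) (ω : Set ι) =>
          (if σ'.1 = {0} then (1 : ℝ) else if (0 : Fin (n + 2)) ∈ σ'.1 then 0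
            else (-1 : ℝ) ^ (σ'.1.card + 1) * rch σ'.1.card (1 - (p e : ℝ)) * (σ'.1.card.factorial : ℝ)) *
          ind (if σ'.1 = {0} then secAt e false A else if (0 : Fin (n + 2)) ∈ σ'.1 then (∅ : Set (Set ι))
            else ⋂ j ∈ SqFree.pre σ'.1, B j) ω) := by
    intro T hT
    by_cases h0 : z0 ∈ T
    · rw [sahiEOn_merged_eq_smul e A B _ _ h0, sahiEOn_merged_update_eq p e A B hB 0 T]
      refine mul_nonneg (Finset.prod_nonneg fun σ' _ => psi_nonneg hs0 hs1 (Finset.card_pos.mpr σ'.2)) (H T hT h0)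
    · rw [sahiEOn_merged_eq_zero e A B _ _ hT h0]
  have hT₁mem : T₁ ∈ blockFamilies (univ : Finset (Fin (n + 2))) := singletons_mem_blockFamilies
  have hz0T₁ : z0 ∈ T₁ := zeroBlock_mem_singletons
  have hsing : sahiEOn (bernoulliWeight (update p e 0)) T₁ (fun (σ' : NEFinset (Fin (n + 2))) (ω : Set ι) =>
          (if σ'.1 = {0} then (1 : ℝ) else if (0 : Fin (n + 2)) ∈ σ'.1 then 0
            else (-1 : ℝ) ^ (σ'.1.card + 1) * rch σ'.1.card (1 - (p e : ℝ)) * (σ'.1.card.factorial : ℝ)) *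
          ind (if σ'.1 = {0} then secAt e false A else if (0 : Fin (n + 2)) ∈ σ'.1 then (∅ : Set (Set ι))
            else ⋂ j ∈ SqFree.pre σ'.1, B j) ω) =
      (1 - (p e : ℝ)) ^ (n + 1) * sahiE (bernoulliWeight p) (n + 2) (Matrix.vecCons (ind (secAt e false A)) (fun j => ind (B j))) := by
    rw [sahiEOn_merged_eq_smul e A B _ _ hz0T₁, sahiEOn_merged_update_eq p e A B hB 0 T₁, prod_psi_singletons,
      sahiEOn_merged_singletons e A B]
  have hE0 : 0 ≤ sahiE (bernoulliWeight p) (n + 2) (Matrix.vecCons (ind (secAt e false A)) (fun j => ind (B j))) := by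
    have h := H T₁ hT₁mem hz0T₁
    rwa [sahiEOn_merged_singletons e A B] at h
  have hM : (1 - (p e : ℝ)) ^ (n + 1) * sahiE (bernoulliWeight p) (n + 2) (Matrix.vecCons (ind (secAt e false A)) (fun j => ind (B j))) ≤
      ∑ T ∈ blockFamilies (univ : Finset (Fin (n + 2))),
        sahiEOn (bernoulliWeight (update p e 0)) T (fun (σ' : NEFinset (Fin (n + 2))) (ω : Set ι) =>
          (if σ'.1 = {0} then (1 : ℝ) else if (0 : Fin (n + 2)) ∈ σ'.1 then 0
            else (-1 : ℝ) ^ (σ'.1.card + 1) * rch σ'.1.card (1 - (p e : ℝ)) * (σ'.1.card.factorial : ℝ)) *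
          ind (if σ'.1 = {0} then secAt e false A else if (0 : Fin (n + 2)) ∈ σ'.1 then (∅ : Set (Set ι))
            else ⋂ j ∈ SqFree.pre σ'.1, B j) ω) := by
    rw [← hsing]
    exact Finset.single_le_sum hterm hT₁mem
  constructor
  · exact hM.trans hge
  · exact (mul_nonneg (pow_nonneg hs0 _) hE0).trans (hM.trans hge)

end Main




end OrShape
end Summit.CriticalPhenomena.PercolationContinuityZ3.Theorems
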